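import Summits.QuantumFields.YangMills.Theorems.ToronValleyVolumeLojasiewiczLocaliseRing
import Summits.QuantumFields.YangMills.Theorems.ToronValleyVolumeLojasiewiczLocaliseSeam
import Summits.QuantumFields.YangMills.Theorems.SwapTwistDeficitPeriodicRingFloorCommBox
import Summits.QuantumFields.YangMills.Theorems.LuscherReductionRunningReductionAxialGaugeInner
import HarnessLib

/-!
# The fixed-`L` periodic CEILING, I: a small deficit forces the tree-gauged ring history INTO the nearly-commuting box
# (the converse of ✓`PeriodicRingFloor.ringDeficit_le_of_commBox`; free-hands support of ⟨stmt-QuantumFields-24497⟩ `ToronValleyVolume.ToronTubeVolumeLaw`)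

In the tree-gauge coordinates `x = (w, r, g) ∈ X_fix` of a `2L`-slice ring history `P = (glue w ∷ r, g)` (✓`VirialFluxGapTreeGaugeGibbsTransfer`), with
`δ = √F₀(P)`, `F₀ = ringDeficit L 0`:

* the four LEADERS — the wrap links `C_μ = w(−ê_μ, μ)` of slice `0` and the seam value `c = g 0` — pairwise commute up to `20L²·δ` in Frobenius norm;
* every other off-tree link of slice `0` is within `12L²·δ` of its LETTER (`C_μ` if the link crosses the seam `x_μ = −1`, else `1`);
* every link of the slices `1, …, 2L−1` is within `4L·δ` of the corresponding link of slice `0`;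
* every seam value `g x` is within `12L²·δ` of `g 0`

(★ `commBox_of_ringDeficit`).  Everything is assembled from the landed rigidity estimates of ✓`ToronValleyVolume.Lojasiewicz` (seat fcl-p3 g33:
✓`fd_slice_zero_le'`, ✓`fd_seam_zero_le`, ✓`sqrt_two_action_le`, ✓`fd_sub_base_le_of_treeEdge`, ✓`fd_comm_wrapReps_le`) and of lane A's comb
(✓`fd_treeFix_combFlat_le`, ✓`treeFix_glue`).  With ✓`PeriodicRingFloor`'s Fubini bookkeeping and the four-letter CEILING ✓`NearlyCommutingCeiling.haar_pi_nearlyCommuting_le`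
this gives the fixed-`L` ceiling `μ_L{F₀ ≤ u} ≤ C_L·u^{9L⁴−3/2}·log u⁻¹` (sequel file), the other half of ✓`PeriodicRingFloor.log_volume_floor` (w3 g61).
HONEST LABEL: a deterministic Frobenius-norm estimate on a fixed lattice; ⟨24497⟩ (two-sided, poly(L)-uniform, t^θ-precise) is NOT proved, nor ⟨24196⟩ or any rung;
the Yang–Mills mass gap is NOT proved; no summit is proved by a line.  Seat ym-line-fcl-p3 g43 (cell ym-idea-1, free hands; `--supports stmt-QuantumFields-24497`).
THEOREMS ONLY (0 `def`, 0 `sorry`), standard axioms.  References: [cite: Luscher1983, §2]; [cite: GonzalezarroyoAltes1988]; [folklore].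
-/

set_option autoImplicit false

noncomputable section

open scoped Quaternion Matrix BigOperators Matrix.Norms.Frobenius
open Literature.MathematicalPhysics.QuantumFieldTheory hiding SU2
open Literature.MathematicalPhysics.QuantumLattice

namespace Summit.QuantumFields.YangMills.Theorems.ToronValleyVolume.PeriodicRingCeiling

open Summit.QuantumFields.YangMills.Theorems.FemtoTransferGap
open Summit.QuantumFields.YangMills.Theorems.FemtoTransferGap.TT
open Summit.QuantumFields.YangMills.Theorems.FemtoTransferGap.TwoLattice
open Summit.QuantumFields.YangMills.Theorems.FemtoTransferGap.TwoLattice.Flat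
open Summit.QuantumFields.YangMills.Theorems.FemtoTransferGap.TwoLattice.Cov
open Summit.QuantumFields.YangMills.Theorems.VirialFluxGap.RingDeficit
open Summit.QuantumFields.YangMills.Theorems.ToronValleyVolume.Lojasiewicz
open Summit.QuantumFields.YangMills.Theorems.SwapTwistDeficit.PeriodicRingFloor

variable {L : ℕ} [NeZero L]

/-! ## §1 Dictionary: tree-gauge letters and lane A's comb objects -/

omit [NeZero L] in
/-- The wrap edge of lane A's comb in direction `k` is the edge `(−ê_k, k)`. [folklore] -/
theorem mk3_wrap_eq_single (k : Fin 3) :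
    (mk3 (if k = 0 then (-1 : ZMod L) else 0) (if k = 1 then (-1 : ZMod L) else 0) (if k = 2 then (-1 : ZMod L) else 0) : Site 3 L) =
      Pi.single k (-1 : ZMod L) := by
  ext j
  fin_cases k <;> fin_cases j <;> simp [mk3]

/-- On a glued (tree-gauged) slice the wrap representatives ARE the leader links. [folklore] -/
theorem wrapReps_glue (w : OffIdx L → SU2) (k : Fin 3) :
    wrapReps (glue w) k = w ⟨(Pi.single k (-1 : ZMod L), k), leader_not_treeEdge k⟩ := by
  rw [Lojasiewicz.wrapReps_eq, treeFix_glue]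
  have he : ((mk3 (if k = 0 then (-1 : ZMod L) else 0) (if k = 1 then (-1 : ZMod L) else 0) (if k = 2 then (-1 : ZMod L) else 0), k) : Edge 3 L) =
      (Pi.single k (-1 : ZMod L), k) := by rw [mk3_wrap_eq_single]
  rw [he, glue_apply_of_not_tree w (leader_not_treeEdge k)]

/-- `fd X 1 = ‖X − 1‖_F`. [folklore] -/
theorem fd_one_eq (X : SU2) : fd X 1 = frobNorm ((X : Matrix (Fin 2) (Fin 2) ℂ) - 1) := by
  unfold fd; simp

/-- The Frobenius norm of a commutator is the distance of the group commutator to `1`. [folklore] -/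
theorem frobNorm_comm_eq_fd (x y : SU2) :
    frobNorm (((x * y : SU2) : Matrix (Fin 2) (Fin 2) ℂ) - ((y * x : SU2) : Matrix (Fin 2) (Fin 2) ℂ)) = fd (x * y * x⁻¹ * y⁻¹) 1 := by
  rw [← norm_su2Rep_commutator_eq, norm_su2Rep_sub_one, fd_one_eq]

/-- `‖A⁻¹X − 1‖_F = fd X A`. [folklore] -/
theorem frobNorm_inv_mul_sub_one_eq_fd (A X : SU2) :
    frobNorm ((((A⁻¹ * X : SU2)) : Matrix (Fin 2) (Fin 2) ℂ) - 1) = fd X A := by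
  rw [frobNorm_inv_mul_sub_one]; rfl

/-! ## §2 The box conditions from a small deficit -/

/-- Slices: every link of slice `j + 1` is within `4L·√F₀` of the corresponding link of slice `0`. [cite: Luscher1983, §2] -/
theorem slices_near (w : OffIdx L → SU2) (r : Fin (2 * L - 1) → GaugeConfig 3 L SU2) (g : Site 3 L → SU2)
    (j : Fin (2 * L - 1)) (e : Edge 3 L) :
    frobNorm ((((glue w e)⁻¹ * r j e : SU2) : Matrix (Fin 2) (Fin 2) ℂ) - 1) ≤
      4 * (L : ℝ) * Real.sqrt (ringDeficit L (fun _ => false) ((Fin.cons (glue w) r : Fin (2 * L - 1 + 1) → GaugeConfig 3 L SU2), g)) := by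
  rw [frobNorm_inv_mul_sub_one_eq_fd]
  have h := fd_slice_zero_le' ((Fin.cons (glue w) r : Fin (2 * L - 1 + 1) → GaugeConfig 3 L SU2), g) j.succ e
  simpa only [Fin.cons_succ, Fin.cons_zero] using h

/-- Seam: every seam value is within `12L(L−1)·√F₀ ≤ 12L²√F₀` of `g 0`. [cite: Luscher1983, §2] -/
theorem seam_near (w : OffIdx L → SU2) (r : Fin (2 * L - 1) → GaugeConfig 3 L SU2) (g : Site 3 L → SU2) (x : Site 3 L) :
    frobNorm ((((g 0)⁻¹ * g x : SU2) : Matrix (Fin 2) (Fin 2) ℂ) - 1) ≤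
      12 * (L : ℝ) ^ 2 * Real.sqrt (ringDeficit L (fun _ => false) ((Fin.cons (glue w) r : Fin (2 * L - 1 + 1) → GaugeConfig 3 L SU2), g)) := by
  set P : (Fin (2 * L - 1 + 1) → GaugeConfig 3 L SU2) × (Site 3 L → SU2) := (Fin.cons (glue w) r, g) with hP
  set δ := Real.sqrt (ringDeficit L (fun _ => false) P) with hδ
  have hδ0 : 0 ≤ δ := Real.sqrt_nonneg _
  have hL1 : (1 : ℝ) ≤ L := by exact_mod_cast NeZero.one_le
  have hρ0 : 0 ≤ 4 * (L : ℝ) * δ := by positivity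
  -- jumps across tree edges
  have hjump : ∀ e : Edge 3 L, treeEdge e = true → fd (g (e.1.shift e.2)) (g e.1) ≤ 4 * (L : ℝ) * δ := by
    intro e he
    have h1 := fd_seam_zero_le P e
    have hP1 : P.1 0 = glue w := rfl
    have hP2 : P.2 = g := rfl
    rw [hP1, hP2, glue_apply_of_tree w he] at h1
    have e1 : gaugeTransform g (glue w) e = g e.1 * glue w e * (g (e.1.shift e.2))⁻¹ := rfl
    rw [e1, glue_apply_of_tree w he, mul_one, fd_comm, fd_mul_inv_one] at h1
    rwa [fd_comm]
  rw [frobNorm_inv_mul_sub_one_eq_fd]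
  calc fd (g x) (g 0) ≤ 3 * ((L : ℝ) - 1) * (4 * (L : ℝ) * δ) := fd_sub_base_le_of_treeEdge hρ0 hjump x
    _ ≤ 12 * (L : ℝ) ^ 2 * δ := by nlinarith

/-- Letters: every off-tree link of slice `0` is within `12L²·√F₀` of its letter. [cite: Luscher1983, §2] -/
theorem letters_near (w : OffIdx L → SU2) (r : Fin (2 * L - 1) → GaugeConfig 3 L SU2) (g : Site 3 L → SU2) (i : OffIdx L) :
    frobNorm ((((if i.1.1 i.1.2 = -1 then w ⟨(Pi.single i.1.2 (-1 : ZMod L), i.1.2), leader_not_treeEdge i.1.2⟩ else 1)⁻¹ * w i : SU2) :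
        Matrix (Fin 2) (Fin 2) ℂ) - 1) ≤
      12 * (L : ℝ) ^ 2 * Real.sqrt (ringDeficit L (fun _ => false) ((Fin.cons (glue w) r : Fin (2 * L - 1 + 1) → GaugeConfig 3 L SU2), g)) := by
  set P : (Fin (2 * L - 1 + 1) → GaugeConfig 3 L SU2) × (Site 3 L → SU2) := (Fin.cons (glue w) r, g) with hP
  set δ := Real.sqrt (ringDeficit L (fun _ => false) P) with hδ
  have hδ0 : 0 ≤ δ := Real.sqrt_nonneg _
  have hL1 : (1 : ℝ) ≤ L := by exact_mod_cast NeZero.one_le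
  have hL0 : (0 : ℝ) ≤ (L : ℝ) - 1 := by linarith
  have hS : Real.sqrt (2 * wilsonAction su2Rep (glue w)) ≤ 2 * δ := by
    have h := sqrt_two_action_le P
    have hP1 : P.1 0 = glue w := rfl
    rwa [hP1] at h
  rw [frobNorm_inv_mul_sub_one_eq_fd]
  -- the comb-flat comparison of lane A, on the glued slice
  have h := fd_treeFix_combFlat_le (glue w) i.1
  rw [treeFix_glue, combFlat_apply, glue_apply_of_not_tree w i.2] at h
  have hletter : (if i.1.1 i.1.2 = -1 then wrapReps (glue w) i.1.2 else 1) =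
      (if i.1.1 i.1.2 = -1 then w ⟨(Pi.single i.1.2 (-1 : ZMod L), i.1.2), leader_not_treeEdge i.1.2⟩ else 1) := by
    rw [wrapReps_glue]
  rw [hletter] at h
  calc fd (w i) _ ≤ ((L : ℝ) - 1) * ((6 * (L : ℝ) - 4) * Real.sqrt (2 * wilsonAction su2Rep (glue w))) := h
    _ ≤ ((L : ℝ) - 1) * ((6 * (L : ℝ) - 4) * (2 * δ)) :=
        mul_le_mul_of_nonneg_left (mul_le_mul_of_nonneg_left hS (by linarith)) hL0
    _ ≤ 12 * (L : ℝ) ^ 2 * δ := by nlinarith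

/-- Leaders: the wrap links pairwise commute up to `20L²·√F₀` (Frobenius). [cite: Luscher1983, §2] -/
theorem wraps_comm (w : OffIdx L → SU2) (r : Fin (2 * L - 1) → GaugeConfig 3 L SU2) (g : Site 3 L → SU2) (μ ν : Fin 3) :
    frobNorm (((w ⟨(Pi.single μ (-1 : ZMod L), μ), leader_not_treeEdge μ⟩ * w ⟨(Pi.single ν (-1 : ZMod L), ν), leader_not_treeEdge ν⟩ : SU2) :
          Matrix (Fin 2) (Fin 2) ℂ) -
        ((w ⟨(Pi.single ν (-1 : ZMod L), ν), leader_not_treeEdge ν⟩ * w ⟨(Pi.single μ (-1 : ZMod L), μ), leader_not_treeEdge μ⟩ : SU2) :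
          Matrix (Fin 2) (Fin 2) ℂ)) ≤
      20 * (L : ℝ) ^ 2 * Real.sqrt (ringDeficit L (fun _ => false) ((Fin.cons (glue w) r : Fin (2 * L - 1 + 1) → GaugeConfig 3 L SU2), g)) := by
  set P : (Fin (2 * L - 1 + 1) → GaugeConfig 3 L SU2) × (Site 3 L → SU2) := (Fin.cons (glue w) r, g) with hP
  set δ := Real.sqrt (ringDeficit L (fun _ => false) P) with hδ
  have hδ0 : 0 ≤ δ := Real.sqrt_nonneg _
  have hL1 : (1 : ℝ) ≤ L := by exact_mod_cast NeZero.one_le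
  have hS : Real.sqrt (2 * wilsonAction su2Rep (glue w)) ≤ 2 * δ := by
    have h := sqrt_two_action_le P
    have hP1 : P.1 0 = glue w := rfl
    rwa [hP1] at h
  rw [frobNorm_comm_eq_fd, ← wrapReps_glue w μ, ← wrapReps_glue w ν]
  have hC : combC L ≤ 10 * (L : ℝ) ^ 2 := by unfold combC; nlinarith
  have hC0 : 0 ≤ combC L := le_trans zero_le_one one_le_combC
  calc fd (wrapReps (glue w) μ * wrapReps (glue w) ν * (wrapReps (glue w) μ)⁻¹ * (wrapReps (glue w) ν)⁻¹) 1
      ≤ combC L * Real.sqrt (2 * wilsonAction su2Rep (glue w)) := fd_comm_wrapReps_le (glue w) μ ν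
    _ ≤ combC L * (2 * δ) := mul_le_mul_of_nonneg_left hS hC0
    _ ≤ 10 * (L : ℝ) ^ 2 * (2 * δ) := mul_le_mul_of_nonneg_right hC (by positivity)
    _ = 20 * (L : ℝ) ^ 2 * δ := by ring

/-- Leaders: the seam value `g 0` commutes with every wrap link up to `12L²·√F₀` (Frobenius). [cite: Luscher1983, §2] -/
theorem seam_wrap_comm (w : OffIdx L → SU2) (r : Fin (2 * L - 1) → GaugeConfig 3 L SU2) (g : Site 3 L → SU2) (k : Fin 3) :
    frobNorm (((g 0 * w ⟨(Pi.single k (-1 : ZMod L), k), leader_not_treeEdge k⟩ : SU2) : Matrix (Fin 2) (Fin 2) ℂ) -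
        ((w ⟨(Pi.single k (-1 : ZMod L), k), leader_not_treeEdge k⟩ * g 0 : SU2) : Matrix (Fin 2) (Fin 2) ℂ)) ≤
      12 * (L : ℝ) ^ 2 * Real.sqrt (ringDeficit L (fun _ => false) ((Fin.cons (glue w) r : Fin (2 * L - 1 + 1) → GaugeConfig 3 L SU2), g)) := by
  set P : (Fin (2 * L - 1 + 1) → GaugeConfig 3 L SU2) × (Site 3 L → SU2) := (Fin.cons (glue w) r, g) with hP
  set δ := Real.sqrt (ringDeficit L (fun _ => false) P) with hδ
  have hδ0 : 0 ≤ δ := Real.sqrt_nonneg _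
  have hL1 : (1 : ℝ) ≤ L := by exact_mod_cast NeZero.one_le
  set ρ : ℝ := 4 * (L : ℝ) * δ with hρ
  have hρ0 : 0 ≤ ρ := by positivity
  have hP1 : P.1 0 = glue w := rfl
  -- the seam moves the glued slice by at most `ρ` per link
  have hsV : ∀ e, fd (glue w e) (gaugeTransform g (glue w) e) ≤ ρ := fun e => by
    have h := fd_seam_zero_le P e
    rwa [hP1] at h
  have hjump : ∀ e : Edge 3 L, treeEdge e = true → fd (g (e.1.shift e.2)) (g e.1) ≤ ρ := by
    intro e he
    have h1 := hsV e
    have e1 : gaugeTransform g (glue w) e = g e.1 * glue w e * (g (e.1.shift e.2))⁻¹ := rfl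
    rw [e1, glue_apply_of_tree w he, mul_one, fd_comm, fd_mul_inv_one] at h1
    rwa [fd_comm]
  set c : SU2 := g 0 with hc
  have hsc : ∀ x, fd (g x) c ≤ 3 * ((L : ℝ) - 1) * ρ := fun x => fd_sub_base_le_of_treeEdge hρ0 hjump x
  -- the wrap edge `(m, k)` ends at the origin
  set m : Site 3 L := mk3 (if k = 0 then (-1 : ZMod L) else 0) (if k = 1 then (-1 : ZMod L) else 0) (if k = 2 then (-1 : ZMod L) else 0) with hm
  have hwk : wrapReps (glue w) k = glue w (m, k) := by rw [Lojasiewicz.wrapReps_eq, treeFix_glue]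
  have hshift : m.shift k = 0 := wrapEdge_shift k
  have h1 := hsV (m, k)
  have e1 : gaugeTransform g (glue w) (m, k) = g m * glue w (m, k) * c⁻¹ := by
    rw [show gaugeTransform g (glue w) (m, k) = g m * glue w (m, k) * (g (m.shift k))⁻¹ from rfl, hshift]
  rw [e1, ← hwk] at h1
  set W : SU2 := wrapReps (glue w) k with hW
  have h2 : fd (g m * W * c⁻¹) (c * W * c⁻¹) = fd (g m) c := by rw [fd_mul_right, fd_mul_right]
  have h3 := hsc m
  have hWc : fd W (c * W * c⁻¹) ≤ 12 * (L : ℝ) ^ 2 * δ := by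
    calc fd W (c * W * c⁻¹) ≤ fd W (g m * W * c⁻¹) + fd (g m * W * c⁻¹) (c * W * c⁻¹) := fd_triangle _ _ _
      _ ≤ ρ + 3 * ((L : ℝ) - 1) * ρ := by rw [h2]; exact add_le_add h1 h3
      _ ≤ 12 * (L : ℝ) ^ 2 * δ := by rw [hρ]; nlinarith
  rw [← wrapReps_glue w k, ← hW, ← frobNorm_conj_sub_self]
  have e2 : frobNorm (((c * W * c⁻¹ : SU2) : Matrix (Fin 2) (Fin 2) ℂ) - (W : Matrix (Fin 2) (Fin 2) ℂ)) = fd (c * W * c⁻¹) W := rfl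
  rw [e2, fd_comm]
  exact hWc

/-- ★★ **A small deficit puts the tree-gauged ring history INTO the nearly-commuting box** (converse of ✓`ringDeficit_le_of_commBox`): with
`δ = √F₀(glue w ∷ r, g)`, the leaders pairwise commute up to `20L²δ`, the other off-tree links of slice `0` are within `12L²δ` of their letters,
the slices within `4Lδ ≤ 12L²δ` of slice `0`, the seam within `12L²δ` of `g 0`. [cite: Luscher1983, §2] [cite: GonzalezarroyoAltes1988] -/
theorem commBox_of_ringDeficit (w : OffIdx L → SU2) (r : Fin (2 * L - 1) → GaugeConfig 3 L SU2) (g : Site 3 L → SU2) :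
    (∀ μ ν : Fin 3,
      frobNorm (((w ⟨(Pi.single μ (-1 : ZMod L), μ), leader_not_treeEdge μ⟩ * w ⟨(Pi.single ν (-1 : ZMod L), ν), leader_not_treeEdge ν⟩ : SU2) :
          Matrix (Fin 2) (Fin 2) ℂ) -
        ((w ⟨(Pi.single ν (-1 : ZMod L), ν), leader_not_treeEdge ν⟩ * w ⟨(Pi.single μ (-1 : ZMod L), μ), leader_not_treeEdge μ⟩ : SU2) :
          Matrix (Fin 2) (Fin 2) ℂ)) ≤
        20 * (L : ℝ) ^ 2 * Real.sqrt (ringDeficit L (fun _ => false) ((Fin.cons (glue w) r : Fin (2 * L - 1 + 1) → GaugeConfig 3 L SU2), g))) ∧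
    (∀ μ : Fin 3,
      frobNorm (((g 0 * w ⟨(Pi.single μ (-1 : ZMod L), μ), leader_not_treeEdge μ⟩ : SU2) : Matrix (Fin 2) (Fin 2) ℂ) -
        ((w ⟨(Pi.single μ (-1 : ZMod L), μ), leader_not_treeEdge μ⟩ * g 0 : SU2) : Matrix (Fin 2) (Fin 2) ℂ)) ≤
        20 * (L : ℝ) ^ 2 * Real.sqrt (ringDeficit L (fun _ => false) ((Fin.cons (glue w) r : Fin (2 * L - 1 + 1) → GaugeConfig 3 L SU2), g))) ∧
    (∀ i : OffIdx L, frobNorm ((((if i.1.1 i.1.2 = -1 then w ⟨(Pi.single i.1.2 (-1 : ZMod L), i.1.2), leader_not_treeEdge i.1.2⟩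
        else 1)⁻¹ * w i : SU2) : Matrix (Fin 2) (Fin 2) ℂ) - 1) ≤
        12 * (L : ℝ) ^ 2 * Real.sqrt (ringDeficit L (fun _ => false) ((Fin.cons (glue w) r : Fin (2 * L - 1 + 1) → GaugeConfig 3 L SU2), g))) ∧
    (∀ (j : Fin (2 * L - 1)) (e : Edge 3 L), frobNorm ((((glue w e)⁻¹ * r j e : SU2) : Matrix (Fin 2) (Fin 2) ℂ) - 1) ≤
        12 * (L : ℝ) ^ 2 * Real.sqrt (ringDeficit L (fun _ => false) ((Fin.cons (glue w) r : Fin (2 * L - 1 + 1) → GaugeConfig 3 L SU2), g))) ∧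
    (∀ x, frobNorm ((((g 0)⁻¹ * g x : SU2) : Matrix (Fin 2) (Fin 2) ℂ) - 1) ≤
        12 * (L : ℝ) ^ 2 * Real.sqrt (ringDeficit L (fun _ => false) ((Fin.cons (glue w) r : Fin (2 * L - 1 + 1) → GaugeConfig 3 L SU2), g))) := by
  have hδ0 : 0 ≤ Real.sqrt (ringDeficit L (fun _ => false) ((Fin.cons (glue w) r : Fin (2 * L - 1 + 1) → GaugeConfig 3 L SU2), g)) :=
    Real.sqrt_nonneg _
  have hL1 : (1 : ℝ) ≤ L := by exact_mod_cast NeZero.one_le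
  have h12 : 12 * (L : ℝ) ^ 2 ≤ 20 * (L : ℝ) ^ 2 := by nlinarith
  have h4 : 4 * (L : ℝ) ≤ 12 * (L : ℝ) ^ 2 := by nlinarith
  exact ⟨fun μ ν => wraps_comm w r g μ ν, fun μ => (seam_wrap_comm w r g μ).trans (mul_le_mul_of_nonneg_right h12 hδ0),
    fun i => letters_near w r g i, fun j e => (slices_near w r g j e).trans (mul_le_mul_of_nonneg_right h4 hδ0), fun x => seam_near w r g x⟩

end Summit.QuantumFields.YangMills.Theorems.ToronValleyVolume.PeriodicRingCeiling

end
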